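import Literature.MathematicalPhysics.QuantumFieldTheory.Balaban1983to89.Beta.RemainderChain

/-!
# Gaps / EndDrawdownUpperWitness — N-19: in the drawdown node's END edge SOME per-level UPPER control of the remainder is LOAD-BEARING.
# A PRINTED SPLIT with constant one-loop part `β⁰ ≡ 2` (bounded drawdown below EVERY line `r ≤ 2`, in particular below `rlo = 1`), remainder
# `β¹_{k+1}(g_0,…,g_k) := 1∕g_k² − 3 + g_k` on `g_k > 0` and `0` at `g_k ≤ 0` (the printed vanishing), satisfying the one-sided LOWER bound
# (Q3) `−1 ≤ β¹` on the `]0,1]`-histories and (C) on the `]0,1]`-boxes, whose canonical forward-generated realization `FlowStepRuns.modelOf`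
# has NO `EndpointExistence` (the first RG step maps every bare coupling `g_0 < 1` to `g_1 = (1 − g_0)^{−1∕2} ≥ 1`): so the hypothesis
# «(Q4)_k: ∀ k ∃ r_k, β¹_{k+1} ≤ r_k on the `]0,γ₀]`-histories» of this seat's END edge `Gaps.EndDrawdownBand.endpointExistence_of_dwSeq_lower_locUpper`
# (fwd-gen ∧ bounded drawdown `DwSeq β⁰ rlo` ∧ (Q3) ∧ (Q4)_k ∧ (C) ⟹ E) CANNOT BE DELETED — the family violates it at every level (blow-up as
# `g_k ↓ 0`) and nothing else.  This TYPES the «HONEST ∕ NOT TYPED HERE» clause of g1-plan-2 GEN 24's rider R-44a (HOME kernel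
# `g1/skeletons/B12Thm2SubDag_plan2.lean` v1.15 §13f docstring, there phrased with the blow-up family of their GEN-17 kernel §10 = this seat's
# gen-7 port `Gaps.EndUpperLetterWitness.betaU`, which admits no printed split with constant one-loop part; here the split-compatible variant)
# (cell pub-balaban-gaps, seat g1-p3 GEN 8, rows CAP ∕ tail «split ∕ weakening»; file 7 of «the one-loop interface of the END statement»;
# this seat's own leaf, independent of the other six — imports `Beta.RemainderChain` only)

HONEST FRAMING (cell rule, page 1 of everything): a TOY β-family on the tree's carrier `FlowStep.HBeta` with a printed split (`B12Beta.OneLoopSplit`),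
realised by the tree's canonical construction `FlowStepRuns.modelOf`; [folklore] one-step arithmetic of (0.20).  Physically absurd (that is what
the printed upper bound (U) ∕ row (D4)'s upper remainder constant exclude) — its only job is to certify that a HYPOTHESIS of a tree theorem is
not idle.  Nothing of Bałaban's is asserted; 0∕6 binders; 0 coefficients certified; one finite T⁴; NOT [I] Thm 2, NOT `BetaPertH`, NOT the
continuum limit, NOT Clay.  The drawdown hypothesis is written UNFOLDED (`∃ M, ∀ k ≤ n, −M ≤ Σ_{[k,n)} (β⁰_j − rlo)`, definitionally
`Gaps.EndDrawdownSeq.DwSeq Sβ.β0 rlo`) so that this leaf does not wait for the oleans of the other GEN-8 leaves.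

CITATION HEADER (tags CONTEXT ONLY).  [I] = T. Bałaban, Commun. Math. Phys. **109** (1987) 249–301 [Balaban1987RG1]: (0.20) p. 256, Thm 2 p. 259
(first sentence), §1 p. 264 («uniformly bounded»), (2.12)–(2.14) p. 268 (the split, `β¹ = 0` at `g_k = 0`).
-/

namespace Summit.QuantumFields.BalabanUV.Gaps.EndDrawdownUpperWitness

open Literature.MathematicalPhysics.QuantumFieldTheory.Balaban1983to89
open Literature.MathematicalPhysics.QuantumFieldTheory.Balaban1983to89.FlowStep
open Literature.MathematicalPhysics.QuantumFieldTheory.Balaban1983to89.FlowStepRuns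
open Literature.MathematicalPhysics.QuantumFieldTheory.Balaban1983to89.DagBinding
open Finset

noncomputable section

/-! ## §1 The family: constant one-loop part `2`, blow-up remainder with the printed vanishing -/

/-- The remainder: `β¹_{k+1}(g_0,…,g_k) := 1∕g_k² − 3 + g_k` for `g_k > 0`, and `0` for `g_k ≤ 0` (the printed vanishing at `g_k = 0`).  A TOY. [folklore] -/
def beta1V : (k : ℕ) → (Fin (k + 1) → ℝ) → ℝ := fun k p =>
  if 0 < p (Fin.last k) then 1 / (p (Fin.last k)) ^ 2 - 3 + p (Fin.last k) else 0

/-- The family: `β_{k+1} := 2 + β¹_{k+1}` — on histories with `g_k > 0` it is the blow-up family `1∕g_k² − 1 + g_k` of `Gaps.EndUpperLetterWitness`.  A TOY. [folklore] -/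
def betaV : HBeta := fun k p => 2 + beta1V k p

/-- Its PRINTED SPLIT: `β⁰ ≡ 2`, `β¹ := beta1V` (vanishing at `g_k = 0` by the `if`). [folklore] -/
def splitV : B12Beta.OneLoopSplit betaV where
  β0 := fun _ => 2
  β1 := beta1V
  split := fun _ _ => rfl
  vanish := fun k p hp => by simp [beta1V, hp]

/-- On a history with positive last coupling: `β_{k+1} = 1∕g_k² − 1 + g_k`. [folklore] -/
theorem betaV_of_pos (k : ℕ) {p : Fin (k + 1) → ℝ} (hp : 0 < p (Fin.last k)) :
    betaV k p = 1 / (p (Fin.last k)) ^ 2 - 1 + p (Fin.last k) := by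
  simp only [betaV, beta1V, if_pos hp]
  ring

/-- On a history with positive last coupling: `β¹_{k+1} = 1∕g_k² − 3 + g_k`. [folklore] -/
theorem beta1V_of_pos (k : ℕ) {p : Fin (k + 1) → ℝ} (hp : 0 < p (Fin.last k)) :
    beta1V k p = 1 / (p (Fin.last k)) ^ 2 - 3 + p (Fin.last k) := by
  simp only [beta1V, if_pos hp]

/-! ## §2 The letters it carries: bounded drawdown of `β⁰` below every line `r ≤ 2`, (Q3) with `rlo = 1` on `]0,1]`, (C), forward generation -/

/-- BOUNDED DRAWDOWN of the one-loop part below the `1`-line with `M = 0` (every term `2 − 1 ≥ 0`); this is `Gaps.EndDrawdownSeq.DwSeq splitV.β0 1`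
unfolded. [folklore] -/
theorem drawdown_splitV : ∃ M : ℝ, ∀ k n : ℕ, k ≤ n → -M ≤ ∑ j ∈ Finset.Ico k n, (splitV.β0 j - 1) :=
  ⟨0, fun k n _ => by
    rw [neg_zero]
    exact Finset.sum_nonneg fun j _ => by
      show (0 : ℝ) ≤ 2 - 1
      norm_num⟩

/-- (Q3) with `rlo = 1` on the `]0,1]`-histories: `−1 ≤ 1∕g² − 3 + g` for `0 < g ≤ 1`, i.e. `2 ≤ 1∕g² + g` there (equality at `g = 1`; the map
`g ↦ 1∕g² + g − 2` decreases on `]0,1]`). [folklore] -/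
theorem remainderLower_splitV : ∀ (k : ℕ) (p : Fin (k + 1) → ℝ), p ∈ B12Beta.HistBox 1 k → -1 ≤ splitV.β1 k p := by
  intro k p hp
  have h := hp (Fin.last k)
  show -1 ≤ beta1V k p
  rw [beta1V_of_pos k h.1]
  have hg : 0 < p (Fin.last k) := h.1
  have hg1 : p (Fin.last k) ≤ 1 := h.2
  have hkey : 2 * (p (Fin.last k)) ^ 2 ≤ 1 + (p (Fin.last k)) ^ 3 := by
    nlinarith [mul_pos hg hg, sq_nonneg (1 - p (Fin.last k)), mul_nonneg hg.le (sq_nonneg (1 - p (Fin.last k)))]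
  have h2 : 2 ≤ 1 / (p (Fin.last k)) ^ 2 + p (Fin.last k) := by
    rw [div_add' _ _ _ (pow_ne_zero 2 hg.ne'), le_div_iff₀ (pow_pos hg 2)]
    nlinarith [hkey]
  linarith

/-- (C): jointly continuous on every box (there `g_k > 0`, where the family is `1∕g_k² − 1 + g_k`). [folklore] -/
theorem betaContH_betaV (γ : ℝ) : BetaContH γ betaV := by
  intro k
  have hcont : ContinuousOn (fun q : Fin (k + 1) → ℝ => 1 / (q (Fin.last k)) ^ 2 - 1 + q (Fin.last k)) (Box γ k) := by
    apply continuousOn_of_forall_continuousAt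
    intro p hp
    have hp0 : 0 < p (Fin.last k) := ((mem_box).mp hp (Fin.last k)).1
    have h1 : ContinuousAt (fun q : Fin (k + 1) → ℝ => q (Fin.last k)) p := continuousAt_apply (Fin.last k) p
    have h3 : ContinuousAt (fun q : Fin (k + 1) → ℝ => (1 : ℝ) / (q (Fin.last k)) ^ 2) p :=
      continuousAt_const.div (h1.pow 2) (pow_ne_zero 2 hp0.ne')
    exact (h3.sub continuousAt_const).add h1
  exact hcont.congr fun p hp => betaV_of_pos k ((mem_box.mp hp) (Fin.last k)).1

/-- NO PER-LEVEL UPPER BOUND on the remainder on any box `]0,γ₀]` (`γ₀ > 0`): `β¹_{k+1}(…, g) ≥ 1∕g² − 3 → +∞` as `g ↓ 0` — the hypothesis (Q4)_k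
of the drawdown END edge FAILS for this family at EVERY level. [folklore] -/
theorem not_locUpper_splitV {γ₀ : ℝ} (hγ₀ : 0 < γ₀) (k : ℕ) :
    ¬ ∃ r : ℝ, ∀ p : Fin (k + 1) → ℝ, p ∈ B12Beta.HistBox γ₀ k → splitV.β1 k p ≤ r := by
  rintro ⟨r, hr⟩
  -- a coupling `g ∈ ]0,γ₀]` with `1∕g² > r + 3`
  obtain ⟨g, hg0, hgγ, hgr⟩ : ∃ g : ℝ, 0 < g ∧ g ≤ γ₀ ∧ r + 3 < 1 / g ^ 2 := by
    set s : ℝ := min γ₀ (1 / (|r| + 4)) with hs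
    have hs0 : 0 < s := lt_min hγ₀ (by positivity)
    refine ⟨s, hs0, min_le_left _ _, ?_⟩
    have hs1 : s ≤ 1 / (|r| + 4) := min_le_right _ _
    have hs4 : s * (|r| + 4) ≤ 1 := by
      have := mul_le_mul_of_nonneg_right hs1 (by positivity : (0 : ℝ) ≤ |r| + 4)
      rwa [one_div_mul_cancel (by positivity : (|r| + 4 : ℝ) ≠ 0)] at this
    have hsle1 : s ≤ 1 := by nlinarith [abs_nonneg r]
    rw [lt_div_iff₀ (pow_pos hs0 2)]
    nlinarith [le_abs_self r, abs_nonneg r, mul_pos hs0 hs0]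
  have hp : (fun _ : Fin (k + 1) => g) ∈ B12Beta.HistBox γ₀ k := fun _ => ⟨hg0, hgγ⟩
  have h := hr _ hp
  have hval : splitV.β1 k (fun _ : Fin (k + 1) => g) = 1 / g ^ 2 - 3 + g := beta1V_of_pos k (p := fun _ => g) hg0
  rw [hval] at h
  linarith

/-! ## §3 No END for its canonical forward-generated realization -/

/-- The flow of `modelOf betaV` from ANY bare coupling misses `]0, 1∕2]` at `K = 1` (`1∕g_1² = 1 − g_0`): NOT the END.  Same one-step arithmetic as
`Gaps.EndUpperLetterWitness.not_endpointExistence_betaU` (the two families agree on positive histories). [folklore] -/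
theorem not_endpointExistence_betaV : ¬ EndpointExistence (modelOf betaV) := by
  intro hE
  obtain ⟨γ₂, hγ₂, h⟩ := hE 0
  obtain ⟨gstar, hgstar, h⟩ := h γ₂ hγ₂ le_rfl
  have hgpos : 0 < min gstar (1 / 2) := lt_min hgstar (by norm_num)
  obtain ⟨g0, hI, hK⟩ := h (min gstar (1 / 2)) hgpos (min_le_left _ _) 1
  have hP0 : 0 < genSeq betaV g0 0 ∧ genSeq betaV g0 0 ≤ γ₂ := hI 0 (Nat.zero_le _)
  rw [genSeq_zero] at hP0
  have hK' : genSeq betaV g0 1 = min gstar (1 / 2) := hK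
  have hβ0 : betaV 0 (prefixOf (genSeq betaV g0) 0) = 1 / g0 ^ 2 - 1 + g0 := by
    have hlast : prefixOf (genSeq betaV g0) 0 (Fin.last 0) = g0 := by
      simp only [prefixOf_apply, Fin.val_last, genSeq_zero]
    rw [betaV_of_pos 0 (by rw [hlast]; exact hP0.1), hlast]
  rw [genSeq_succ, genSeq_zero, hβ0] at hK'
  have hs : 1 / g0 ^ 2 - (1 / g0 ^ 2 - 1 + g0) = 1 - g0 := by ring
  rw [hs] at hK'
  rcases le_or_gt (1 - g0) 0 with hle | hgt
  · have h1 := solveCoupling_nonpos hle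
    linarith
  · have h1 := inv_sq_solveCoupling hgt
    rw [hK'] at h1
    have hm : min gstar (1 / 2) ≤ 1 / 2 := min_le_right _ _
    have h4 : 4 ≤ 1 / (min gstar (1 / 2)) ^ 2 := by
      rw [le_div_iff₀ (pow_pos hgpos 2)]
      nlinarith [hm, hgpos]
    linarith [hP0.1]

/-! ## §4 N-19: the per-level upper hypothesis of the drawdown END edge cannot be deleted -/

/-- **N-19 · THE DRAWDOWN END EDGE IS FALSE WITHOUT ITS PER-LEVEL UPPER REMAINDER HYPOTHESIS.**  It is NOT the case that for every history family
with a printed split, every forward-generated construction and every box: bounded drawdown of `β⁰` below the `rlo`-line ∧ (Q3) `−rlo ≤ β¹` on the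
`]0,γ₀]`-histories ∧ (C) ⟹ `EndpointExistence` — witness `betaV` ∕ `splitV`, `modelOf betaV`, `γ₀ = rlo = 1`.  So in
`Gaps.EndDrawdownBand.endpointExistence_of_dwSeq_lower_locUpper` the hypothesis (Q4)_k («∀ k ∃ r_k, β¹ ≤ r_k on the histories») is load-bearing —
per level; NO uniformity in `k` is consumed (that file), but SOME upper control is (this one).  Types g1-plan-2 R-44a's untyped clause. [folklore] -/
theorem drawdownEdge_false_without_locUpper :
    ¬ ∀ (β : HBeta) (Sβ : B12Beta.OneLoopSplit β) (Cn : B12.Construction) (γ₀ rlo : ℝ),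
        ForwardGenerated Cn β → 0 < γ₀ →
        (∃ M : ℝ, ∀ k n : ℕ, k ≤ n → -M ≤ ∑ j ∈ Finset.Ico k n, (Sβ.β0 j - rlo)) →
        (∀ (k : ℕ) (p : Fin (k + 1) → ℝ), p ∈ B12Beta.HistBox γ₀ k → -rlo ≤ Sβ.β1 k p) →
        BetaContH γ₀ β → EndpointExistence Cn :=
  fun h => not_endpointExistence_betaV
    (h betaV splitV (modelOf betaV) 1 1 (modelOf_forwardGenerated _) one_pos drawdown_splitV remainderLower_splitV
      (betaContH_betaV 1))

/-- THE WITNESS OF RECORD IN ONE STATEMENT · a printed split with: one-loop part constant `2` (so bounded drawdown below every line `r ≤ 2`, bounded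
above, convergent, in the drift class of slope `2` — every one-loop letter of every END road), remainder `≥ −1` on the `]0,1]`-histories, (C) on every box,
NO per-level upper remainder bound at any level, and NO `EndpointExistence` for its canonical forward-generated construction. [folklore] -/
theorem upperRemainder_loadBearing_census :
    (∀ j : ℕ, splitV.β0 j = 2) ∧
      (∀ (k : ℕ) (p : Fin (k + 1) → ℝ), p ∈ B12Beta.HistBox 1 k → -1 ≤ splitV.β1 k p) ∧
      (∀ γ : ℝ, BetaContH γ betaV) ∧ ForwardGenerated (modelOf betaV) betaV ∧
      (∀ γ₀ : ℝ, 0 < γ₀ → ∀ k : ℕ, ¬ ∃ r : ℝ, ∀ p : Fin (k + 1) → ℝ, p ∈ B12Beta.HistBox γ₀ k → splitV.β1 k p ≤ r) ∧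
      ¬ EndpointExistence (modelOf betaV) :=
  ⟨fun _ => rfl, remainderLower_splitV, betaContH_betaV, modelOf_forwardGenerated _, fun _ hγ₀ k => not_locUpper_splitV hγ₀ k,
    not_endpointExistence_betaV⟩

end

end Summit.QuantumFields.BalabanUV.Gaps.EndDrawdownUpperWitness
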